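/-
Copyright: the b2b-balaban T⁴-continuum CRUX team, row NE7b OWNER lineage `t4-ne7b-p1` (gen 127). Project licence.
-/
import Summits.QuantumFields.BalabanUV.T4Continuum.Spine.NE7b.SupFrdPieceDecay
import Summits.QuantumFields.BalabanUV.T4Continuum.Spine.NE7b.SupFibreGaussianScaleSplit

/-!
# LARGE FIELDS ARE EXPONENTIALLY RARE AT FINE SCALES: for a centred Gaussian vector with positive semidefinite covariance `S` and
# diagonal `S(i,i) ≤ s`, `P(∃ i, |ω_i| ≥ κ) ≤ #ι · 2e^{−κ²∕(2s)}` (coordinate laws `N(0, S(i,i))` by Mathlib, the tree's two-sided Gaussian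
# tail, a union bound; the degenerate coordinates `S(i,i) = 0` are Dirac masses); for (273)'s data the scale-`N` chart field `N(0, c·C_N(cM_z))`
# of (280) has diagonal `≤ c·π⁴∕(4·4^N·(cmp)²)` ((284)'s Loewner bound), so its small-field condition `|ζ_N| < κ` everywhere fails with
# probability `≤ #σ · 2exp(−κ²·4^N·(cmp)²∕(2c·π⁴∕4))` — the first input of any large-field bookkeeping on the finite-range route
# (row NE7b, node U5c; (280)∕(284) + Mathlib ∕ tree BY NAME; [folklore])

Cell `pub-balaban`, sub-cell `t4`, spine estimate NE7b (`T4WeightBudget.RelWeightBound`; the cell's OWN estimate — NOT PRINTED in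
[Bałaban 1983–89], NOT PROVED).  Crux-route work under `Spine/NE7b/` by the row OWNER (`t4-ne7b-p1` gen 127, file (285)) under FREEZE
(0)'s crux-prover clause, on § [NE7bP1-G126-HANDOFF] NEXT (3)(d), at TEA's level; NOTHING of Bałaban's is named as a Lean object, valued or
asserted; no `T4Continuum/Support` leaf typed; no `def`, no notation; zero `sorry`.  Imports (BY NAME): the OWNER's (284) `…SupFrdPieceDecay`
(`frdPiece_le`, `four_sub_scaled_posSemidef` ∕ `scaled_isHermitian` through (273), `form_chart_eq` through (271)), (280)
`…SupFibreGaussianScaleSplit` (`scale_posSemidef`); Mathlib's `ProbabilityTheory.measurePreserving_eval_multivariateGaussian`,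
`gaussianReal_zero_var`, `MeasureTheory.measureReal_iUnion_fintype_le`, `MeasurePreserving.measureReal_preimage`; the tree's
`GaussianToolkit.gaussianReal_real_abs_ge_le` (two-sided tail `P(|Y| ≥ x) ≤ 2e^{−x²∕(2v)}`).

WHY (located).  The polymer gas of the finite-range route ((282)) takes SUP-bounded cell factors; the road's factors are bounded only
where the fluctuation field is small, so every honest continuation splits each scale field into small ∕ large and pays for the large
fields by their probability.  The Gaussian input for that is here: the scale-`N` field's coordinates have variance `O(4^{−N})` by (284),
hence Gaussian tails `e^{−κ²4^N∕O(1)}` and a union bound over the finitely many chart coordinates.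

WHAT IS PROVED ([folklore]):
* §1 (any finite `ι`, `S` positive semidefinite) `coord_tail_le` (`P(κ ≤ |ω_i|) ≤ 2e^{−κ²∕(2s)}` whenever `S(i,i) ≤ s`, `0 ≤ κ`),
  **`gaussian_largeField_le`** (`P(∃ i, κ ≤ |ω_i|) ≤ #ι·2e^{−κ²∕(2s)}`).
* §2 (273)'s data: `scaled_floor_posSemidef` (`(cmp)·1 ≤ cM_z`), `scale_diag_le` (`(c·C_N)(j,j) ≤ c·π⁴∕(4·4^N·(cmp)²)`), THE END
  **`scale_largeField_le`** (`N(0, c·C_N(cM_z))`-probability of `∃ j, κ ≤ |ζ_j|` is `≤ #σ · 2exp(−κ²∕(2·c·π⁴∕(4·4^N·(cmp)²)))`); §3 toy.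

HONEST (what this is NOT).  Gaussian tails + union bound by name; not the conditional ∕ iterated large-field structure of Bałaban's `T∘R`
steps, no small-field characteristic functions typed, no polymer activities; the `#σ` prefactor is the crude union bound (volume-dependent
— the honest place where extensivity must come from the cluster expansion, not from probabilities); scalar skeleton ((A3), NC-NE7b-α
UNRULED); nothing of Bałaban's asserted.  BY-NAME EFFECT ON THE WALL: NONE.  NE7b NOT PRINTED ∕ NOT PROVED; spine PROVED 0∕9; rung (B)+1 —
the programme's measures remain FINITE-torus statements; NOT the mass gap, NOT Clay.  HONEST DEPENDENCY: continuum YM on T⁴ ⇐ BetaPertH ∧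
nine spine estimates (0∕9 proved); BetaPertH ⇐ (D1) ∧ (D4) ∧ CAP+tail; G-an2-4 gates asym, D1 and NE2∕3∕4.
-/

set_option autoImplicit false

noncomputable section

namespace Summit.QuantumFields.BalabanUV.T4Continuum.NE7b.SupFibreScaleSmallField

open MeasureTheory ProbabilityTheory Matrix Real
open Literature.Analysis.Matrix (frdPiece posSemidef_frdPiece)
open Literature.MathematicalPhysics.QuantumFieldTheory.GaussianToolkit (gaussianReal_real_abs_ge_le)
open SupFibreGaussianCovariance (form_chart_eq)
open SupFibreFiniteRangeDecomposition (scaled_isHermitian four_sub_scaled_posSemidef)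
open SupFibreGaussianScaleSplit (scale_posSemidef)
open SupFrdPieceDecay (frdPiece_le)

/-! ## §1. Gaussian tails of the coordinates and the union bound -/

section Generic

variable {ι : Type} [Fintype ι] [DecidableEq ι]

/-- **THE TAIL OF ONE COORDINATE**: `S` positive semidefinite, `S(i,i) ≤ s`, `0 ≤ κ` ⟹
`P_{N(0,S)}(κ ≤ |ω_i|) ≤ 2e^{−κ²∕(2s)}` (coordinate law `N(0, S(i,i))`; a Dirac mass when `S(i,i) = 0`). [folklore] -/
theorem coord_tail_le {S : Matrix ι ι ℝ} (hS : S.PosSemidef) {s κ : ℝ} (hκ : 0 ≤ κ) (i : ι) (hSi : S i i ≤ s) :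
    (multivariateGaussian 0 S).real {ω : EuclideanSpace ℝ ι | κ ≤ |ω i|} ≤ 2 * exp (-κ ^ 2 / (2 * s)) := by
  have hmp := measurePreserving_eval_multivariateGaussian (μ := (0 : EuclideanSpace ℝ ι)) hS (i := i)
  have hmeas : MeasurableSet {y : ℝ | κ ≤ |y|} := measurableSet_le measurable_const (measurable_id.abs)
  have hpre : {ω : EuclideanSpace ℝ ι | κ ≤ |ω i|} = (fun ω : EuclideanSpace ℝ ι => ω i) ⁻¹' {y : ℝ | κ ≤ |y|} := rfl
  rw [hpre, hmp.measureReal_preimage hmeas.nullMeasurableSet]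
  have h0i : 0 ≤ S i i := hS.diag_nonneg
  simp only [PiLp.zero_apply]
  rcases h0i.eq_or_lt with hzero | hpos
  · -- degenerate coordinate: a Dirac mass at `0`
    rw [← hzero, Real.toNNReal_zero, gaussianReal_zero_var, measureReal_def, Measure.dirac_apply' _ hmeas]
    rcases hκ.eq_or_lt with hκ0 | hκpos
    · have : (0 : ℝ) ∈ {y : ℝ | κ ≤ |y|} := by simp [← hκ0]
      rw [Set.indicator_of_mem this]
      simp only [Pi.one_apply, ENNReal.toReal_one]
      have : exp (-κ ^ 2 / (2 * s)) = 1 := by rw [← hκ0]; simp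
      linarith
    · have : (0 : ℝ) ∉ {y : ℝ | κ ≤ |y|} := by simp; linarith
      rw [Set.indicator_of_notMem this]
      simp only [ENNReal.toReal_zero]
      positivity
  · have htail := gaussianReal_real_abs_ge_le (S i i).toNNReal hκ
    rw [Real.coe_toNNReal _ h0i] at htail
    refine htail.trans ?_
    have hmono : exp (-κ ^ 2 / (2 * S i i)) ≤ exp (-κ ^ 2 / (2 * s)) := by
      rw [exp_le_exp, neg_div, neg_div, neg_le_neg_iff]
      exact div_le_div_of_nonneg_left (sq_nonneg κ) (by positivity) (by linarith)
    linarith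

/-- **LARGE FIELDS ARE RARE**: `S` positive semidefinite with diagonal `≤ s`, `0 ≤ κ` ⟹
`P_{N(0,S)}(∃ i, κ ≤ |ω_i|) ≤ #ι · 2e^{−κ²∕(2s)}`. [folklore] -/
theorem gaussian_largeField_le {S : Matrix ι ι ℝ} (hS : S.PosSemidef) {s κ : ℝ} (hκ : 0 ≤ κ) (hdiag : ∀ i, S i i ≤ s) :
    (multivariateGaussian 0 S).real {ω : EuclideanSpace ℝ ι | ∃ i, κ ≤ |ω i|} ≤ Fintype.card ι * (2 * exp (-κ ^ 2 / (2 * s))) := by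
  have hU : {ω : EuclideanSpace ℝ ι | ∃ i, κ ≤ |ω i|} = ⋃ i, {ω : EuclideanSpace ℝ ι | κ ≤ |ω i|} := by
    ext ω; simp
  rw [hU]
  refine (measureReal_iUnion_fintype_le _).trans ?_
  calc ∑ i, (multivariateGaussian 0 S).real {ω : EuclideanSpace ℝ ι | κ ≤ |ω i|}
      ≤ ∑ _i : ι, 2 * exp (-κ ^ 2 / (2 * s)) := Finset.sum_le_sum fun i _ => coord_tail_le hS hκ i (hdiag i)
    _ = Fintype.card ι * (2 * exp (-κ ^ 2 / (2 * s))) := by rw [Finset.sum_const, Finset.card_univ, nsmul_eq_mul]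

end Generic

/-! ## §2. The scale-`N` chart field of the fluctuation measure -/

section Fibre

variable {ι : Type*} [Fintype ι] {σ : Type} [Fintype σ] [DecidableEq σ]
  {H : (ι → ℝ) →L[ℝ] (ι → ℝ) →L[ℝ] ℝ} {m p ΛH q : ℝ} (P : (σ → ℝ) →L[ℝ] (ι → ℝ))

/-- **THE SCALED CHART PRECISION MATRIX HAS THE FLOOR `cmp`**: `(cmp)·1 ≤ cM_z` for `c ≥ 0`. [folklore] -/
theorem scaled_floor_posSemidef (hHsym : ∀ h k : ι → ℝ, H h k = H k h) (hfl : ∀ h : ι → ℝ, m * ∑ x, h x ^ 2 ≤ H h h) (hm : 0 ≤ m)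
    (hP : ∀ z : σ → ℝ, p * ∑ i, z i ^ 2 ≤ ∑ x, P z x ^ 2) (Mz : Matrix σ σ ℝ)
    (hMz : ∀ j k, Mz j k = H (P (Pi.single j 1)) (P (Pi.single k 1))) {c : ℝ} (hc : 0 ≤ c) :
    (c • Mz - (c * m * p) • (1 : Matrix σ σ ℝ)).PosSemidef := by
  refine Matrix.PosSemidef.of_dotProduct_mulVec_nonneg
    ((scaled_isHermitian P hHsym Mz hMz c).sub (Matrix.isHermitian_one.smul (IsSelfAdjoint.all _))) fun z => ?_
  rw [star_trivial, sub_mulVec, dotProduct_sub, smul_mulVec, smul_mulVec, one_mulVec, dotProduct_smul, dotProduct_smul, smul_eq_mul,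
    smul_eq_mul, ← form_chart_eq P Mz hMz, sub_nonneg]
  have hzz : z ⬝ᵥ z = ∑ i, z i ^ 2 := Finset.sum_congr rfl fun i _ => by ring
  rw [hzz]
  have h1 := hfl (P z)
  have h2 := mul_le_mul_of_nonneg_left (hP z) hm
  calc c * m * p * ∑ i, z i ^ 2 = c * (m * (p * ∑ i, z i ^ 2)) := by ring
    _ ≤ c * (m * ∑ x, P z x ^ 2) := mul_le_mul_of_nonneg_left h2 hc
    _ ≤ c * H (P z) (P z) := mul_le_mul_of_nonneg_left h1 hc

/-- **THE SCALE-`N` VARIANCES ARE `O(4^{−N})`**: for (273)'s data, every diagonal entry of `c·C_N(cM_z)` is `≤ c·π⁴∕(4·4^N·(cmp)²)`. [folklore] -/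
theorem scale_diag_le (hHsym : ∀ h k : ι → ℝ, H h k = H k h) (hfl : ∀ h : ι → ℝ, m * ∑ x, h x ^ 2 ≤ H h h) (hm : 0 < m)
    (hceil : ∀ h : ι → ℝ, H h h ≤ ΛH * ∑ x, h x ^ 2) (hΛH : 0 < ΛH) (hP : ∀ z : σ → ℝ, p * ∑ i, z i ^ 2 ≤ ∑ x, P z x ^ 2)
    (hp : 0 < p) (hPceil : ∀ z : σ → ℝ, ∑ x, P z x ^ 2 ≤ q * ∑ i, z i ^ 2) (hq : 0 < q) (Mz : Matrix σ σ ℝ)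
    (hMz : ∀ j k, Mz j k = H (P (Pi.single j 1)) (P (Pi.single k 1))) (N : ℕ) (j : σ) :
    ((4 / (ΛH * q)) • frdPiece ((4 / (ΛH * q)) • Mz) N) j j
      ≤ (4 / (ΛH * q)) * (π ^ 4 / (4 * 4 ^ N * ((4 / (ΛH * q)) * m * p) ^ 2)) := by
  have hc : (0 : ℝ) < 4 / (ΛH * q) := by positivity
  have hK := frdPiece_le ((4 / (ΛH * q)) • Mz) (scaled_isHermitian P hHsym Mz hMz _) (by positivity : 0 < (4 / (ΛH * q)) * m * p)
    (scaled_floor_posSemidef P hHsym hfl hm.le hP Mz hMz hc.le) (four_sub_scaled_posSemidef P hHsym hceil hΛH hPceil hq Mz hMz) N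
  have hd : 0 ≤ ((π ^ 4 / (4 * 4 ^ N * ((4 / (ΛH * q)) * m * p) ^ 2)) • (1 : Matrix σ σ ℝ)
      - frdPiece ((4 / (ΛH * q)) • Mz) N) j j := hK.diag_nonneg
  rw [Matrix.sub_apply, Matrix.smul_apply, Matrix.one_apply_eq, smul_eq_mul, mul_one, sub_nonneg] at hd
  rw [Matrix.smul_apply, smul_eq_mul]
  exact mul_le_mul_of_nonneg_left hd hc.le

/-- **HEADLINE — THE SCALE-`N` FLUCTUATION FIELD IS SMALL EXCEPT ON AN EXPONENTIALLY RARE EVENT.**  For (273)'s data (`H` symmetric with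
floor `m > 0` and ceiling `Λ_H > 0`, chart bound `p > 0` and ceiling `q > 0`, `M_z(j,k) = H(Pe_j)(Pe_k)`, `c = 4∕(Λ_Hq)`), every scale `N` and
every threshold `κ ≥ 0`: under the scale-`N` law `N(0, c·C_N(cM_z))` of (280),
`P(∃ j, κ ≤ |ζ_j|) ≤ #σ · 2exp(−κ²∕(2·c·π⁴∕(4·4^N·(cmp)²)))`. [folklore] -/
theorem scale_largeField_le (hHsym : ∀ h k : ι → ℝ, H h k = H k h) (hfl : ∀ h : ι → ℝ, m * ∑ x, h x ^ 2 ≤ H h h) (hm : 0 < m)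
    (hceil : ∀ h : ι → ℝ, H h h ≤ ΛH * ∑ x, h x ^ 2) (hΛH : 0 < ΛH) (hP : ∀ z : σ → ℝ, p * ∑ i, z i ^ 2 ≤ ∑ x, P z x ^ 2)
    (hp : 0 < p) (hPceil : ∀ z : σ → ℝ, ∑ x, P z x ^ 2 ≤ q * ∑ i, z i ^ 2) (hq : 0 < q) (Mz : Matrix σ σ ℝ)
    (hMz : ∀ j k, Mz j k = H (P (Pi.single j 1)) (P (Pi.single k 1))) (N : ℕ) {κ : ℝ} (hκ : 0 ≤ κ) :
    (multivariateGaussian 0 ((4 / (ΛH * q)) • frdPiece ((4 / (ΛH * q)) • Mz) N)).real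
        {ω : EuclideanSpace ℝ σ | ∃ j, κ ≤ |ω j|}
      ≤ Fintype.card σ * (2 * exp (-κ ^ 2 / (2 * ((4 / (ΛH * q)) * (π ^ 4 / (4 * 4 ^ N * ((4 / (ΛH * q)) * m * p) ^ 2)))))) := by
  have hc : (0 : ℝ) < 4 / (ΛH * q) := by positivity
  exact gaussian_largeField_le (scale_posSemidef P hHsym Mz hMz hc.le N) hκ
    (scale_diag_le P hHsym hfl hm hceil hΛH hP hp hPceil hq Mz hMz N)

end Fibre

/-! ## §3. Toy -/

/-- Toy: for the standard Gaussian on `ℝ²` (diagonal `1 ≤ 1`) the probability that some coordinate exceeds `κ = 3` is at most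
`2·2e^{−9∕2}` (§1's union bound). -/
example : (multivariateGaussian 0 (1 : Matrix (Fin 2) (Fin 2) ℝ)).real {ω : EuclideanSpace ℝ (Fin 2) | ∃ i, (3 : ℝ) ≤ |ω i|}
    ≤ Fintype.card (Fin 2) * (2 * exp (-(3 : ℝ) ^ 2 / (2 * 1))) :=
  gaussian_largeField_le Matrix.PosSemidef.one (by norm_num) fun i => by rw [Matrix.one_apply_eq]

end Summit.QuantumFields.BalabanUV.T4Continuum.NE7b.SupFibreScaleSmallField
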